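import Summits.ResolutionOfSingularities.ResolutionOfSingularities.Theorems.FrobeniusClosingPatchingRelPerfectDepthSNCPointwise
import Literature.AlgebraicGeometry.Resolution.MonomialMarkedIdeals
import Literature.AlgebraicGeometry.Resolution.Principalization
import HarnessLib

/-!
# Crux `PatchingRelPerfect` (stmt-ResolutionOfSingularities-16161), chain W5.2 — TargetsF5J `EndTwoMonomialJ`:
# ASSEMBLY of the two-monomial END from its two halves (points of `i(E)` / points off `i(E)`)

[OURS · L1 W5.2 · rung tool] Replaces the role of NO printed item; NOT a statement of the manuscript under review; fact-free.
The END schema `DepthTargets.EndTwoMonomialJ ℓ P` (…DepthMixedTargetsJ) concludes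
`∃ M₀ A B, IsLocallyPrincipal M₀ ∧ boundaryOf A = boundaryOf B ∧ (∀ x ∈ cosupp (mono A ⊔ mono B), SNCWithAt (boundaryOf A) ⊤ x)
∧ K = M₀ * (mono A ⊔ mono B)`. From the X-side format identity `K = 𝓐 * monomialIdeal 𝒢 ⊔ monomialIdeal 𝒩 * 𝓘_E^ℓ`
(res-D-pv-052's `MixedFormatB`: global host factor `𝓐`, boundary `𝒢` with host-exponents, carriers `𝒩` with N-exponents)
this file BUILDS the lists — `M₀ = ⊤`, ONE underlying family `[𝓐, 𝓘_E] ++ (charged members)` with the EXPONENT-ZERO MEMBERS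
FILTERED OUT (res-L1-w52-plan-1 07:30:46Z caveat: an uncharged exceptional divisor may be tangent to the host at a pocket), the
two exponent vectors `(1, 0, h, 0)` and `(0, ℓ, 0, a)` — and reduces the pointwise snc clause to the TWO HALVES: at cosupport
points ON `i(E)` (res-D-pv-052's retraction lift) and OFF `i(E)` (res-D-pv-009's POCKET FIELD, `…DepthPocketInvariant`).

* `monomialIdeal_filter_pos` — dropping exponent-zero entries does not change the monomial ideal;
  `monomialIdeal_map_zero` — a list with all exponents zero gives `⊤`;
* `endFamily 𝓐 J 𝒢 𝒩`, `endListA`, `endListB` (abbreviations for the lists) and their unfoldings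
  `boundaryOf_endListA/B`, `monomialIdeal_endListA/B`;
* **`exists_endTwoMonomial_of_halves`** — the assembly.

## References
* J. Kollár, *Lectures on Resolution of Singularities* (2007), (3.111) Step 3. [Kollar2007]
* E. Bierstone, D. Grigoriev, P. Milman, J. Włodarczyk, arXiv:1206.3090, §4 Step 2b. [BierstoneGrigorievMilmanWlodarczyk2011]
-/

-- `Summit.<Summit>.<Sub>.Theorems` with `Sub = Summit` (single-conjunct summit, D-0017)
set_option linter.dupNamespace false

noncomputable section

open CategoryTheory CategoryTheory.Limits AlgebraicGeometry TopologicalSpace IsLocalRing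
open Literature.AlgebraicGeometry.Resolution
open Scheme.IdealSheafData

namespace Summit.ResolutionOfSingularities.ResolutionOfSingularities.Theorems

universe u

namespace DepthSNC

variable {X : Scheme.{u}}

/-! ## §1 Monomial ideals: exponent-zero entries -/

/-- A list with all exponents replaced by zero gives the unit ideal. [folklore] -/
theorem monomialIdeal_map_zero (L : List (X.IdealSheafData × ℕ)) :
    monomialIdeal (L.map fun p => (p.1, 0)) = ⊤ := by
  induction L with
  | nil => rw [List.map_nil, monomialIdeal_nil]
  | cons p L ih => rw [List.map_cons, monomialIdeal_cons, ih, pow_zero, Scheme.IdealSheafData.one_eq_top,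
      Scheme.IdealSheafData.top_mul]

/-- **Dropping the exponent-zero entries does not change the monomial ideal.** [folklore] -/
theorem monomialIdeal_filter_pos (L : List (X.IdealSheafData × ℕ)) :
    monomialIdeal (L.filter fun p => decide (0 < p.2)) = monomialIdeal L := by
  induction L with
  | nil => rw [List.filter_nil]
  | cons p L ih =>
    by_cases hp : 0 < p.2
    · rw [List.filter_cons_of_pos (by simpa using hp), monomialIdeal_cons, monomialIdeal_cons, ih]
    · rw [List.filter_cons_of_neg (by simpa using hp), monomialIdeal_cons, ih, Nat.eq_zero_of_not_pos hp, pow_zero,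
        Scheme.IdealSheafData.one_eq_top, Scheme.IdealSheafData.top_mul]

/-- Members of the filtered list are members. [folklore] -/
theorem mem_boundaryOf_of_mem_filter_pos {L : List (X.IdealSheafData × ℕ)} {D : X.IdealSheafData}
    (h : D ∈ boundaryOf (L.filter fun p => decide (0 < p.2))) : ∃ a, 0 < a ∧ (D, a) ∈ L := by
  obtain ⟨a, ha⟩ := mem_boundaryOf_iff.mp h
  rw [List.mem_filter] at ha
  exact ⟨a, by simpa using ha.2, ha.1⟩

/-! ## §2 The END lists -/

/-- [OURS · L1 W5.2] **The END family**: host, exceptional hypersurface, the charged boundary members (positive host-exponent),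
the charged carriers (positive N-exponent). -/
abbrev endFamily (𝓐 J : X.IdealSheafData) (𝒢 𝒩 : List (X.IdealSheafData × ℕ)) : List X.IdealSheafData :=
  [𝓐, J] ++ boundaryOf (𝒢.filter fun p => decide (0 < p.2)) ++ boundaryOf (𝒩.filter fun p => decide (0 < p.2))

/-- [OURS · L1 W5.2] **The first END list** (host monomial): exponents `(1, 0, h, 0)`. -/
abbrev endListA (𝓐 J : X.IdealSheafData) (𝒢 𝒩 : List (X.IdealSheafData × ℕ)) : List (X.IdealSheafData × ℕ) :=
  [(𝓐, 1), (J, 0)] ++ 𝒢.filter (fun p => decide (0 < p.2)) ++ (𝒩.filter fun p => decide (0 < p.2)).map fun p => (p.1, 0)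

/-- [OURS · L1 W5.2] **The second END list** (contact monomial): exponents `(0, ℓ, 0, a)`. -/
abbrev endListB (ℓ : ℕ) (𝓐 J : X.IdealSheafData) (𝒢 𝒩 : List (X.IdealSheafData × ℕ)) : List (X.IdealSheafData × ℕ) :=
  [(𝓐, 0), (J, ℓ)] ++ (𝒢.filter (fun p => decide (0 < p.2))).map (fun p => (p.1, 0)) ++ 𝒩.filter fun p => decide (0 < p.2)

variable (ℓ : ℕ) (𝓐 J : X.IdealSheafData) (𝒢 𝒩 : List (X.IdealSheafData × ℕ))

/-- `boundaryOf` of a list with modified exponents. [folklore] -/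
theorem boundaryOf_map_zero (L : List (X.IdealSheafData × ℕ)) :
    boundaryOf (L.map fun p => (p.1, 0)) = boundaryOf L := by
  simp only [boundaryOf, List.map_map]
  rfl

/-- Unfolding: the boundary of the first END list is the END family. [folklore] -/
theorem boundaryOf_endListA : boundaryOf (endListA 𝓐 J 𝒢 𝒩) = endFamily 𝓐 J 𝒢 𝒩 := by
  simp only [endListA, endFamily, boundaryOf_append, boundaryOf_map_zero]
  rfl

/-- Unfolding: the boundary of the second END list is the END family. [folklore] -/
theorem boundaryOf_endListB : boundaryOf (endListB ℓ 𝓐 J 𝒢 𝒩) = endFamily 𝓐 J 𝒢 𝒩 := by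
  simp only [endListB, endFamily, boundaryOf_append, boundaryOf_map_zero]
  rfl

/-- **The first END list gives the host monomial** `𝓐 · monomialIdeal 𝒢`. [folklore] -/
theorem monomialIdeal_endListA : monomialIdeal (endListA 𝓐 J 𝒢 𝒩) = 𝓐 * monomialIdeal 𝒢 := by
  rw [endListA, monomialIdeal_append, monomialIdeal_append, monomialIdeal_map_zero, monomialIdeal_filter_pos,
    monomialIdeal_cons, monomialIdeal_singleton, pow_one, pow_zero, Scheme.IdealSheafData.one_eq_top,
    Scheme.IdealSheafData.mul_top, Scheme.IdealSheafData.mul_top]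

/-- **The second END list gives the contact monomial** `monomialIdeal 𝒩 · J^ℓ`. [folklore] -/
theorem monomialIdeal_endListB : monomialIdeal (endListB ℓ 𝓐 J 𝒢 𝒩) = monomialIdeal 𝒩 * J ^ ℓ := by
  rw [endListB, monomialIdeal_append, monomialIdeal_append, monomialIdeal_map_zero, monomialIdeal_filter_pos,
    monomialIdeal_cons, monomialIdeal_singleton, pow_zero, Scheme.IdealSheafData.one_eq_top,
    Scheme.IdealSheafData.top_mul, Scheme.IdealSheafData.mul_top, mul_comm]

/-! ## §3 The assembly -/

variable {ℓ 𝓐 J 𝒢 𝒩}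

/-- [OURS · L1 W5.2] **ASSEMBLY of `EndTwoMonomialJ`'s conclusion from the two halves.** `i : E ⟶ X` the exceptional
hypersurface, `K = 𝓐 · monomialIdeal 𝒢 ⊔ monomialIdeal 𝒩 · 𝓘_E^ℓ` the format identity (`𝓘_E = i.ker`); ON `i(E)`: simple
normal crossings of the END family at every cosupport point of `K` in `i(E)` (res-D-pv-052's retraction lift of the E-side
END); OFF `i(E)`: the POCKET FIELD for a family `F` containing every END-family member that passes through the point
(res-D-pv-009). Then `M₀ = ⊤`, `A = endListA`, `B = endListB` witness the END.
[cite: Kollar2007, (3.111) Step 3] [cite: BierstoneGrigorievMilmanWlodarczyk2011, §4 Step 2b] -/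
theorem exists_endTwoMonomial_of_halves {E : Scheme.{u}} (i : E ⟶ X) {K : X.IdealSheafData}
    (hK : K = 𝓐 * monomialIdeal 𝒢 ⊔ monomialIdeal 𝒩 * i.ker ^ ℓ)
    (hon : ∀ x : X, x ∈ (K.support : Set X) → x ∈ Set.range i.base → SNCWithAt (endFamily 𝓐 i.ker 𝒢 𝒩) ⊤ x)
    {F : List X.IdealSheafData}
    (hoff : ∀ x : X, x ∈ (K.support : Set X) → x ∉ Set.range i.base → SNCWithAt F ⊤ x)
    (hF : ∀ D ∈ endFamily 𝓐 i.ker 𝒢 𝒩, ∀ x : X, x ∈ D.support → x ∉ Set.range i.base → D ∈ F) :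
    ∃ (M₀ : X.IdealSheafData) (A B : List (X.IdealSheafData × ℕ)),
      IsLocallyPrincipal M₀ ∧ boundaryOf A = boundaryOf B ∧
      (∀ x : X, x ∈ (monomialIdeal A ⊔ monomialIdeal B).support → SNCWithAt (boundaryOf A) ⊤ x) ∧
      K = M₀ * (monomialIdeal A ⊔ monomialIdeal B) := by
  have hAB : monomialIdeal (endListA 𝓐 i.ker 𝒢 𝒩) ⊔ monomialIdeal (endListB ℓ 𝓐 i.ker 𝒢 𝒩) = K := by
    rw [monomialIdeal_endListA, monomialIdeal_endListB, hK]
  refine ⟨⊤, endListA 𝓐 i.ker 𝒢 𝒩, endListB ℓ 𝓐 i.ker 𝒢 𝒩, isLocallyPrincipal_top X, ?_, ?_, ?_⟩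
  · rw [boundaryOf_endListA, boundaryOf_endListB]
  · intro x hx
    rw [hAB] at hx
    rw [boundaryOf_endListA]
    by_cases hxE : x ∈ Set.range i.base
    · exact hon x hx hxE
    · exact (hoff x hx hxE).anti fun D hD hxD => hF D hD x hxD hxE
  · rw [hAB, Scheme.IdealSheafData.top_mul]

/-- **The cosupport of the END sum is the cosupport of `K`** (`M₀ = ⊤`). [folklore] -/
theorem monomialIdeal_endListA_sup_endListB {E : Scheme.{u}} (i : E ⟶ X) {K : X.IdealSheafData}
    (hK : K = 𝓐 * monomialIdeal 𝒢 ⊔ monomialIdeal 𝒩 * i.ker ^ ℓ) :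
    monomialIdeal (endListA 𝓐 i.ker 𝒢 𝒩) ⊔ monomialIdeal (endListB ℓ 𝓐 i.ker 𝒢 𝒩) = K := by
  rw [monomialIdeal_endListA, monomialIdeal_endListB, hK]

end DepthSNC

end Summit.ResolutionOfSingularities.ResolutionOfSingularities.Theorems

end
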